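import Mathlib.GroupTheory.Index
import Mathlib.GroupTheory.Commutator.Basic
import HarnessLib

/-!
# In a group of nilpotency class `2`, a subgroup meeting the centre trivially spans with it an abelian normal direct product (Murthy 2026, Observation 2.9)

Topic `Literature/GroupTheory/Nilpotent` (companion of `PGroupNormalMeetsCenter.lean`, Lemma 2.15 of the
same note, and `FrattiniCommutator.lean`).

S. R. Murthy, *On the triple product property for subgroups of finite nilpotent groups of class 2*,
arXiv:2602.15796v1 (2026), Observation 2.9, p. 7, verbatim:

> **Observation 2.9.** If `G` is a group of nilpotency class `2`, and `H` a subgroup of `G` such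
> that `H ∩ Z(G) = {1}`, then `HZ(G)` is an abelian normal subgroup of `G` and a direct product.
> *Proof.* Let `G` and `H` be given as above, and let `H ∩ Z(G) = {1}`. As `G′ ≤ Z(G)` by
> assumption, `H′ = [H, H] ≤ H ∩ G′ = {1}` and `H` is abelian. As `Z(G)` is normal in `G` the
> product `HZ(G)` is a subgroup of `G`. The quotient `G/Z(G)` is abelian, `HZ(G)/Z(G)` is normal
> in `G/Z(G)` and, therefore, `HZ(G)` is normal in `G` (by the Correspondence Theorem […]).
> Finally, as `H ∩ Z(G) = {1}` then `HZ(G)` is an abelian direct product of order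
> `|HZ(G)| = |H||Z(G)|`. □

"Nilpotency class `2`" is used only through `G′ ≤ Z(G)` (class `≤ 2`), which is how it is stated
below (the tree's convention, cf. `Murthy2026_cor212_3`); no finiteness is needed (`Nat.card`).

## What is here (all proved; 0 definitions, 0 named facts)

* `commute_of_commutator_le_center_of_inf_center_eq_bot` — the first step: `G′ ≤ Z(G)` and
  `H ∩ Z(G) = 1` force `H` abelian (`[a, b] ∈ H ∩ G′ ≤ H ∩ Z(G) = 1`);
* `normal_of_center_le_of_commutator_le_center` — any subgroup containing `Z(G) ⊇ G′` is normal
  (`g k g⁻¹ = [g, k] · k`; the note's correspondence-theorem step);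
* `card_sup_center_of_inf_center_eq_bot` — `|H Z(G)| = |H| · |Z(G)|` when `H ∩ Z(G) = 1`
  (index calculus: `|H ⊔ Z| = |Z| · [H ⊔ Z : Z] = |Z| · [H : H ∩ Z] = |Z| · |H|`);
* `Murthy2026_obs29` — **Observation 2.9** as printed: `H Z(G) = H ⊔ Z(G)` is normal, abelian, and
  of order `|H| · |Z(G)|` (the internal direct product of `H` and `Z(G)`, which meet trivially and
  commute elementwise).

## References
* S. R. Murthy, arXiv:2602.15796v1 (2026): Observation 2.9 with proof, p. 7. [Murthy2026]
-/

namespace Literature.GroupTheory.Nilpotent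

open scoped commutatorElement

variable {G : Type*} [Group G]

/-- In a group of class `≤ 2` (`G′ ≤ Z(G)`), a subgroup `H` with `H ∩ Z(G) = 1` is abelian:
`[a, b] ∈ H ∩ G′ ≤ H ∩ Z(G) = 1` for `a, b ∈ H`. [cite: Murthy2026, Observation 2.9 (proof)] -/
theorem commute_of_commutator_le_center_of_inf_center_eq_bot
    (hclass : commutator G ≤ Subgroup.center G) {H : Subgroup G}
    (hH : H ⊓ Subgroup.center G = ⊥) {a b : G} (ha : a ∈ H) (hb : b ∈ H) : a * b = b * a := by
  have h1 : ⁅a, b⁆ ∈ H ⊓ Subgroup.center G := by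
    refine ⟨?_, hclass ?_⟩
    · rw [commutatorElement_def]
      exact H.mul_mem (H.mul_mem (H.mul_mem ha hb) (H.inv_mem ha)) (H.inv_mem hb)
    · rw [commutator_def]
      exact Subgroup.commutator_mem_commutator (Subgroup.mem_top a) (Subgroup.mem_top b)
  rw [hH, Subgroup.mem_bot, commutatorElement_def, mul_inv_eq_one, mul_inv_eq_iff_eq_mul] at h1
  exact h1

/-- A subgroup containing the centre of a group of class `≤ 2` (`G′ ≤ Z(G) ≤ K`) is normal:
`g k g⁻¹ = [g, k] · k ∈ G′ K = K`. [folklore] (the correspondence-theorem step of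
[cite: Murthy2026, Observation 2.9 (proof)]) -/
theorem normal_of_center_le_of_commutator_le_center (hclass : commutator G ≤ Subgroup.center G)
    {K : Subgroup G} (hK : Subgroup.center G ≤ K) : K.Normal := by
  refine ⟨fun k hk g => ?_⟩
  have hc : g * k * g⁻¹ * k⁻¹ ∈ K := by
    apply hK
    apply hclass
    rw [commutator_def]
    exact Subgroup.commutator_mem_commutator (Subgroup.mem_top g) (Subgroup.mem_top k)
  simpa only [inv_mul_cancel_right] using K.mul_mem hc hk

/-- `|H Z(G)| = |H| · |Z(G)|` when `H ∩ Z(G) = 1` (for any group; `Nat.card`, so both sides are `0`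
when `H ⊔ Z(G)` is infinite): `|H ⊔ Z| = |Z| · [H ⊔ Z : Z]`, `[H ⊔ Z : Z] = [H : H ∩ Z] = |H|`.
[folklore] (the order count of [cite: Murthy2026, Observation 2.9 (proof)]) -/
theorem card_sup_center_of_inf_center_eq_bot {H : Subgroup G} (hH : H ⊓ Subgroup.center G = ⊥) :
    Nat.card ↥(H ⊔ Subgroup.center G) = Nat.card H * Nat.card (Subgroup.center G) := by
  set Z := Subgroup.center G with hZ
  have h1 : Nat.card ↥(Z.subgroupOf (H ⊔ Z)) * (Z.subgroupOf (H ⊔ Z)).index = Nat.card ↥(H ⊔ Z) :=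
    (Z.subgroupOf (H ⊔ Z)).card_mul_index
  have h2 : Nat.card ↥(Z.subgroupOf (H ⊔ Z)) = Nat.card Z :=
    Nat.card_congr (Subgroup.subgroupOfEquivOfLe (le_sup_right : Z ≤ H ⊔ Z)).toEquiv
  have h3 : (Z.subgroupOf (H ⊔ Z)).index = Nat.card H := by
    change Z.relIndex (H ⊔ Z) = Nat.card H
    rw [Subgroup.relIndex_sup_right, ← Subgroup.inf_relIndex_right, inf_comm, hH,
      Subgroup.relIndex_bot_left]
  rw [← h1, h2, h3, mul_comm]

/-- **Murthy 2026, Observation 2.9.** If `G` has nilpotency class `≤ 2` (`G′ ≤ Z(G)`) and the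
subgroup `H` meets the centre trivially, `H ∩ Z(G) = 1`, then `H Z(G) = H ⊔ Z(G)` is an abelian
normal subgroup of `G` of order `|H| · |Z(G)|` (the internal direct product of `H` and `Z(G)`).
[cite: Murthy2026, Observation 2.9] -/
theorem Murthy2026_obs29 (hclass : commutator G ≤ Subgroup.center G) (H : Subgroup G)
    (hH : H ⊓ Subgroup.center G = ⊥) :
    (H ⊔ Subgroup.center G).Normal ∧
      (∀ x ∈ H ⊔ Subgroup.center G, ∀ y ∈ H ⊔ Subgroup.center G, x * y = y * x) ∧
      Nat.card ↥(H ⊔ Subgroup.center G) = Nat.card H * Nat.card (Subgroup.center G) := by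
  refine ⟨normal_of_center_le_of_commutator_le_center hclass le_sup_right, ?_,
    card_sup_center_of_inf_center_eq_bot hH⟩
  intro x hx y hy
  obtain ⟨h₁, hh₁, z₁, hz₁, rfl⟩ := Subgroup.mem_sup_of_normal_right.1 hx
  obtain ⟨h₂, hh₂, z₂, hz₂, rfl⟩ := Subgroup.mem_sup_of_normal_right.1 hy
  rw [Subgroup.mem_center_iff] at hz₁ hz₂
  have hh := commute_of_commutator_le_center_of_inf_center_eq_bot hclass hH hh₁ hh₂
  calc h₁ * z₁ * (h₂ * z₂) = h₁ * (z₁ * h₂) * z₂ := by simp only [mul_assoc]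
    _ = h₁ * (h₂ * z₁) * z₂ := by rw [hz₁ h₂]
    _ = (h₁ * h₂) * (z₁ * z₂) := by simp only [mul_assoc]
    _ = (h₂ * h₁) * (z₂ * z₁) := by rw [hh, hz₁ z₂]
    _ = h₂ * (h₁ * z₂) * z₁ := by simp only [mul_assoc]
    _ = h₂ * (z₂ * h₁) * z₁ := by rw [hz₂ h₁]
    _ = h₂ * z₂ * (h₁ * z₁) := by simp only [mul_assoc]

end Literature.GroupTheory.Nilpotent
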